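import Summits.AnomalousDissipation.AnomalousDissipation.Theorems.MirrorStatisticsLoudTG.Negative.LoadBearing
import Summits.AnomalousDissipation.AnomalousDissipation.Theorems.MirrorVarietyTaylorGreenLoudGalerkinStatesStubTruncation
import Summits.AnomalousDissipation.AnomalousDissipation.Theorems.PumpedMirrorMirrorBoundedFromRestTGStubLimitInheritsMirrorBound
import Literature.Analysis.FluidPDE.SteadyNavierStokesEnergy
import Literature.Analysis.FluidPDE.EnergySpaceTorusGalerkinProofs
import Literature.Analysis.FluidPDE.CylindricalGenerator
import Literature.Analysis.FluidPDE.DissipationAnomalyProofs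
import Literature.Analysis.FluidPDE.MixedNormSeries
import Literature.Analysis.FunctionSpaces.TorusSobolevNormWeakDerivProofs
import HarnessLib

/-!
# Tools for stub `stub_tubeLawTransferK` (T3) of line `regimes`
# (crux `MirrorEnsemble.MirrorStatisticsLoudTG`, stmt-AnomalousDissipation-17693)

The stub T3 transfers a tube inequality `|∫ ⟪∇g v, v⟫| ≤ (C/δ) ∫_N ∑ⱼ ‖∂ⱼv‖²`, known for SMOOTH
solenoidal mean-zero exactly `K`-symmetric fields `v` (`K` = the three coordinate mirrors
`R_i x = update x i (−x i)` of `T³`), to every `L²` class `v ∈ Fix K ⊆ H` of finite enstrophy, with the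
local enstrophy `∫_N ∑ⱼ ‖wⱼ‖²` of its `L²` weak partial derivatives `wⱼ`. This file lands the analytic
ingredients, all for the Fourier (Galerkin) truncations `P_N = Torus.fourierTruncate N`
(Robinson–Rodrigo–Sadowski 2016, §4.1; the tree's `TorusTrigPoly` / `TorusTruncationH1`):

* `exists_hasWeakPartialDeriv_of_eGradNormSq_ne_top` — an `L²(T³; ℝ³)` field of finite spectral
  enstrophy `4π² ∑ₖ |k|² ‖v̂(k)‖² < ∞` has square-integrable weak partial derivatives
  (Riesz–Fischer on the coefficients `2πi kⱼ v̂ᵢ(k)`, `Torus.hasWeakPartialDeriv_of_mFourierCoeff`;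
  Evans 2010, §5.8 Thm. 8, torus form);
* `mFourierCoeff_complexify_of_hasWeakPartialDeriv`, `partialDeriv_fourierTruncate_of_hasWeakPartialDeriv`
  — a weak derivative `wⱼ` has coefficients `2πi kⱼ v̂(k)` (Evans 2010, §5.8 Thm. 8, step 1;
  `Torus.mFourierCoeff_eq_of_hasWeakPartialDeriv`), hence **truncation commutes with weak derivatives**:
  `∂ⱼ (P_N v) = P_N wⱼ` (both are trigonometric polynomials with the same coefficients);
* `mFourierCoeff_complexify_conj_reflMat`, `isKSymm_fourierTruncate_of_ae` — the coefficients of the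
  conjugated field `R_i ∘ v ∘ R_i` of an INTEGRABLE `v` are `R_iℂ v̂(k R_i)` (the continuous case is
  `Torus.mFourierCoeff_complexify_conj_mulVecT`), so an a.e. `K`-symmetric `L²` field has mirror-related
  coefficients and its truncations are EXACTLY `K`-symmetric (`Torus.IsSmooth.ext_mFourierCoeff`;
  Brachet et al. 1983, §2: the symmetries act on Fourier modes); `ae_conj_of_mem_mirrorClass`,
  `coord_of_isKSymm` translate between the crux's coordinatewise clauses and `IsKSymm`;
* `tendsto_setLIntegral_enorm_sq`, `tendsto_setLIntegral_sum_enorm_sq_fourierTruncate` — `L²`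
  convergence passes to the local `L²` mass on any set (restriction is a contraction), in particular
  `∫_S ∑ⱼ ‖P_N wⱼ‖² → ∫_S ∑ⱼ ‖wⱼ‖²` (`Torus.tendsto_eLpNorm_fourierTruncate_sub`, RRS 2016, Lemma 4.1);
* `tendsto_inertialPairing_fourierTruncate` — `∫ ⟪∇g P_N v, P_N v⟫ → ∫ (v ⊗ v) : ∇g` for smooth `g`
  (`P_N v → v` in `L²`, `Torus.continuous_inertialPairing`; FMRT 2001, Ch. IV (1.9));
* `ofReal_setIntegral_sum_norm_sq` — bookkeeping `ofReal ∫_S ∑ⱼ ‖fⱼ‖² = ∫⁻_S ∑ⱼ ‖fⱼ‖ₑ²`;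
* `stub_tubeLawTransferKTools` — the registered tools sub-stub (conjunction of the above).

References: L. C. Evans, *Partial Differential Equations*, 2nd ed. (AMS 2010), §5.2.1, §5.8 Thm. 8,
App. C.4 [Evans2010]; J. C. Robinson, J. L. Rodrigo, W. Sadowski, *The Three-Dimensional Navier–Stokes
Equations* (CUP 2016), §4.1, Lemma 4.1 [RobinsonRodrigoSadowski2016]; C. Foias, O. Manley, R. Rosa,
R. Temam, *Navier–Stokes Equations and Turbulence* (CUP 2001), Ch. IV §1 [FMRTTurbulence2001];
M. E. Brachet et al., J. Fluid Mech. 130 (1983) 411–452, §2 [doi:10.1017/s0022112083001159].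
-/

-- every `Summit.AnomalousDissipation.AnomalousDissipation.…` name repeats the summit = problem segment (tree layout)
set_option linter.dupNamespace false

noncomputable section

namespace Summit.AnomalousDissipation.AnomalousDissipation.Theorems.MirrorEnsembleMirrorStatisticsLoudTG

open MeasureTheory Filter Topology UnitAddTorus
open scoped ENNReal InnerProductSpace NNReal
open Literature.Analysis.FunctionSpaces Literature.Analysis.FluidPDE
open Summit.AnomalousDissipation.AnomalousDissipation.Theorems.MirrorStatisticsLoudTG.Negative (mirrorClass)
open Summit.AnomalousDissipation.AnomalousDissipation.Theorems.TaylorGreenLoudGalerkinStates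
  (reflMat actVec IsKSymm)
open Summit.AnomalousDissipation.AnomalousDissipation.Theorems.TaylorGreenLoudGalerkinStates.Criticality
  (isKSymm_iff_refl_eq reflMat_mul_self actVec_actVec)
open Summit.AnomalousDissipation.AnomalousDissipation.Theorems.TaylorGreenLoudGalerkinStates.TgForceRegular
  (actVec_reflMat_apply)
open Summit.AnomalousDissipation.AnomalousDissipation.Theorems.TaylorGreenLoudGalerkinStates.Truncation
  (vecMul_reflMat_mem_freqBall_iff)
open Summit.AnomalousDissipation.AnomalousDissipation.Theorems.PumpedMirror.MirrorBoundedFromRestTG.SchemeFromRest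
  (update_neg_eq_mulVecT)
open Summit.AnomalousDissipation.AnomalousDissipation.Theorems.PumpedMirror.MirrorBoundedFromRestTG.LimitInherits
  (mFourierCoeff_comp_clm_of_integrable)

/-! ## Weak gradients of finite-enstrophy fields -/

/-- Weak partial derivatives pass to the complexified fields (`complexify` is a real linear isometry
commuting with Bochner integrals). [folklore] -/
theorem hasWeakPartialDeriv_complexify {j : Fin 3}
    {u w : UnitAddTorus (Fin 3) → EuclideanSpace ℝ (Fin 3)} (h : Torus.HasWeakPartialDeriv j u w) :
    Torus.HasWeakPartialDeriv j (EuclideanSpace.complexify ∘ u) (EuclideanSpace.complexify ∘ w) := by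
  intro φ hφ
  have h1 := h φ hφ
  simp only [Function.comp_apply]
  have e1 : (fun x => Torus.partialDeriv j φ x • EuclideanSpace.complexify (u x)) =
      fun x => EuclideanSpace.complexify (Torus.partialDeriv j φ x • u x) := by
    funext x; rw [LinearIsometry.map_smul]
  have e2 : (fun x => φ x • EuclideanSpace.complexify (w x)) =
      fun x => EuclideanSpace.complexify (φ x • w x) := by
    funext x; rw [LinearIsometry.map_smul]
  rw [e1, e2, LinearIsometry.integral_comp_comm, LinearIsometry.integral_comp_comm, h1, map_neg]

/-- **Fourier coefficients of a weak derivative** (Evans 2010, §5.8 Thm. 8, step 1, torus form): if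
`w` is a weak `j`-th partial derivative of `u` (both integrable real fields on `T³`), then
`𝓕(complexify ∘ w)(k) = 2πi kⱼ 𝓕(complexify ∘ u)(k)`. [cite: Evans2010, §5.8 Thm. 8 proof step 1] -/
theorem mFourierCoeff_complexify_of_hasWeakPartialDeriv {j : Fin 3}
    {u w : UnitAddTorus (Fin 3) → EuclideanSpace ℝ (Fin 3)} (hu : Integrable u volume)
    (hw : Integrable w volume) (h : Torus.HasWeakPartialDeriv j u w) (k : Fin 3 → ℤ) :
    mFourierCoeff (EuclideanSpace.complexify ∘ w) k =
      (2 * Real.pi * Complex.I * (k j) : ℂ) • mFourierCoeff (EuclideanSpace.complexify ∘ u) k :=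
  Torus.mFourierCoeff_eq_of_hasWeakPartialDeriv (Torus.integrable_complexify_comp hu)
    (Torus.integrable_complexify_comp hw) (hasWeakPartialDeriv_complexify h) k

/-- **Finite enstrophy gives square-integrable weak partial derivatives.** If `u ∈ L²(T³; ℝ³)` has
finite spectral enstrophy `eGradNormSq u = 4π² ∑ₖ |k|² ‖û(k)‖² < ∞`, then for every axis `j` there is
`wⱼ ∈ L²(T³; ℝ³)` which is a weak `j`-th partial derivative of `u` (Riesz–Fischer on the square-summable
coefficients `2πi kⱼ ûᵢ(k)`, then `Torus.hasWeakPartialDeriv_of_mFourierCoeff`; Evans 2010, §5.8 Thm. 8).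
[cite: Evans2010, §5.8 Thm. 8 (Characterization of H^k by Fourier transform; torus analogue)] -/
theorem exists_hasWeakPartialDeriv_of_eGradNormSq_ne_top :
    ∀ u : UnitAddTorus (Fin 3) → EuclideanSpace ℝ (Fin 3), MemLp u 2 volume → Torus.eGradNormSq u ≠ ⊤ →
      ∃ w : Fin 3 → UnitAddTorus (Fin 3) → EuclideanSpace ℝ (Fin 3),
        (∀ j, Torus.HasWeakPartialDeriv j u (w j)) ∧ (∀ j, MemLp (w j) 2 volume) := by
  intro u hu hG
  have hui : Integrable u volume := hu.integrable one_le_two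
  -- the coefficients of `∂ⱼ uᵢ` are square summable
  set a : Fin 3 → Fin 3 → (Fin 3 → ℤ) → ℂ := fun i j k =>
    (2 * Real.pi * Complex.I * (k j) : ℂ) * mFourierCoeff (fun x => (u x i : ℂ)) k with ha
  have hsum : ∀ i j, Summable fun k => ‖a i j k‖ ^ 2 := by
    intro i j
    have hfin : ∑' k, ‖a i j k‖ₑ ^ 2 ≠ ⊤ :=
      ne_top_of_le_ne_top hG (Torus.tsum_enorm_sq_freq_mul_mFourierCoeff_le hui i j)
    refine (ENNReal.summable_toReal hfin).congr fun k => ?_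
    rw [ENNReal.toReal_pow, toReal_enorm]
  -- Riesz–Fischer
  choose g hg hgc using fun i j => Torus.exists_memLp_two_forall_mFourierCoeff_eq_of_summable (hsum i j)
  refine ⟨fun j x => ∑ i, (g i j x).re • EuclideanSpace.single i (1 : ℝ), fun j => ?_, fun j => ?_⟩
  · exact Torus.hasWeakPartialDeriv_of_mFourierCoeff hu (fun i => hg i j) j (fun i k => hgc i j k)
  · refine MemLp.of_eval_piLp fun i => ?_
    have hfun : (fun x => (∑ i', (g i' j x).re • EuclideanSpace.single i' (1 : ℝ)) i) =
        fun x => (g i j x).re := by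
      funext x
      simp [Finset.sum_apply, Pi.single_apply]
    rw [hfun]
    exact Complex.reCLM.comp_memLp' (hg i j)

/-! ## Truncation commutes with weak derivatives -/

/-- **`∂ⱼ (P_N u) = P_N wⱼ`** for a weak `j`-th partial derivative `wⱼ` of `u` (both integrable): both
sides are real trigonometric polynomials with the coefficients `2πi kⱼ û(k)` on the ball `|k|² ≤ N²`
(`Torus.mFourierCoeff_complexify_partialDeriv`, `Torus.mFourierCoeff_fourierTruncate`,
`mFourierCoeff_complexify_of_hasWeakPartialDeriv`) and smooth functions with equal coefficients coincide
(`Torus.IsSmooth.ext_mFourierCoeff`). [folklore] -/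
theorem partialDeriv_fourierTruncate_of_hasWeakPartialDeriv :
    ∀ (j : Fin 3) (u w : UnitAddTorus (Fin 3) → EuclideanSpace ℝ (Fin 3)), Integrable u volume →
      Integrable w volume → Torus.HasWeakPartialDeriv j u w → ∀ N : ℕ,
        Torus.partialDeriv j (Torus.fourierTruncate N u) = Torus.fourierTruncate N w := by
  intro j u w hu hw h N
  have hPs : Torus.IsSmooth (Torus.fourierTruncate N u) := Torus.isSmooth_fourierTruncate N u
  have hDs : Torus.IsSmooth (Torus.partialDeriv j (Torus.fourierTruncate N u)) := hPs.partialDeriv j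
  have hQs : Torus.IsSmooth (Torus.fourierTruncate N w) := Torus.isSmooth_fourierTruncate N w
  have hcoef : ∀ k, mFourierCoeff (EuclideanSpace.complexify ∘ Torus.partialDeriv j (Torus.fourierTruncate N u)) k =
      mFourierCoeff (EuclideanSpace.complexify ∘ Torus.fourierTruncate N w) k := by
    intro k
    rw [Torus.mFourierCoeff_complexify_partialDeriv hPs j k, Torus.mFourierCoeff_fourierTruncate hu,
      Torus.mFourierCoeff_fourierTruncate hw, mFourierCoeff_complexify_of_hasWeakPartialDeriv hu hw h k]
    split_ifs
    · rfl
    · rw [smul_zero]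
  have heq := Torus.IsSmooth.ext_mFourierCoeff hDs.complexify_comp hQs.complexify_comp hcoef
  funext x
  exact EuclideanSpace.complexify_injective (congrFun heq x)

/-! ## Mirror symmetry of truncations of a.e. mirror-symmetric fields -/

/-- **Coefficients of a conjugated integrable field**: for integrable `u : T³ → ℝ³` and the coordinate
reflection `R_i`, `𝓕(complexify ∘ (R_i ∘ u ∘ R_i))(k) = R_iℂ (𝓕(complexify ∘ u)(k R_i))` (the
continuous case is `Torus.mFourierCoeff_complexify_conj_mulVecT`; here `R_i` preserves Haar measure and a
continuous linear map commutes with the coefficients of an integrable function). [folklore] -/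
theorem mFourierCoeff_complexify_conj_reflMat {u : UnitAddTorus (Fin 3) → EuclideanSpace ℝ (Fin 3)}
    (hu : Integrable u volume) (i : Fin 3) (k : Fin 3 → ℤ) :
    mFourierCoeff (EuclideanSpace.complexify ∘ fun x => actVec (reflMat i) (u (Torus.mulVecT (reflMat i) x))) k =
      Matrix.toEuclideanCLM (n := Fin 3) (𝕜 := ℂ) ((reflMat i).map (Int.cast : ℤ → ℂ))
        (mFourierCoeff (EuclideanSpace.complexify ∘ u) (Matrix.vecMul k (reflMat i))) := by
  have hdet : (reflMat i).det ≠ 0 := Matrix.det_ne_zero_of_left_inverse (reflMat_mul_self i)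
  have h1 : (EuclideanSpace.complexify ∘ fun x => actVec (reflMat i) (u (Torus.mulVecT (reflMat i) x))) =
      fun x => Matrix.toEuclideanCLM (n := Fin 3) (𝕜 := ℂ) ((reflMat i).map (Int.cast : ℤ → ℂ))
        (((EuclideanSpace.complexify ∘ u) ∘ Torus.mulVecT (reflMat i)) x) := by
    funext x
    exact Torus.complexify_toEuclideanCLM_intCast (reflMat i) (u (Torus.mulVecT (reflMat i) x))
  have hint : Integrable ((EuclideanSpace.complexify ∘ u) ∘ Torus.mulVecT (reflMat i)) volume :=
    (Torus.measurePreserving_mulVecT hdet).integrable_comp_of_integrable (Torus.integrable_complexify_comp hu)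
  rw [h1, mFourierCoeff_comp_clm_of_integrable hint, Torus.mFourierCoeff_comp_mulVecT (reflMat_mul_self i)]

/-- **Truncations of a.e. `K`-symmetric integrable fields are exactly `K`-symmetric.** If
`u (R_i x) = R_i (u x)` for a.e. `x` (`i = 0, 1, 2`), then `P_N u (R_i x) = R_i (P_N u x)` for ALL `x`:
the coefficients of `u` are mirror-related, `û(k) = R_iℂ û(k R_i)` (`mFourierCoeff_complexify_conj_reflMat`
and `û = 𝓕(R_i ∘ u ∘ R_i)` by the a.e. symmetry), so the smooth fields `R_i ∘ P_N u ∘ R_i` and `P_N u` have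
the same coefficients (`k ↦ k R_i` preserves the ball) and coincide (`Torus.IsSmooth.ext_mFourierCoeff`).
[folklore] -/
theorem isKSymm_fourierTruncate_of_ae {u : UnitAddTorus (Fin 3) → EuclideanSpace ℝ (Fin 3)}
    (hu : Integrable u volume)
    (hsym : ∀ i : Fin 3, (fun x => u (Torus.mulVecT (reflMat i) x)) =ᵐ[volume]
      fun x => actVec (reflMat i) (u x)) (N : ℕ) :
    IsKSymm (Torus.fourierTruncate N u) := by
  rw [isKSymm_iff_refl_eq]
  intro i
  set L := Matrix.toEuclideanCLM (n := Fin 3) (𝕜 := ℂ) ((reflMat i).map (Int.cast : ℤ → ℂ)) with hL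
  have hPs : Torus.IsSmooth (Torus.fourierTruncate N u) := Torus.isSmooth_fourierTruncate N u
  have hQs : Torus.IsSmooth (fun x => actVec (reflMat i) (Torus.fourierTruncate N u (Torus.mulVecT (reflMat i) x))) :=
    (hPs.comp_mulVecT' (reflMat i)).comp_clm
      (Matrix.toEuclideanCLM (n := Fin 3) (𝕜 := ℝ) ((reflMat i).map (Int.cast : ℤ → ℝ)))
  -- the coefficients of `u` are mirror-related
  have hu_coef : ∀ k, mFourierCoeff (EuclideanSpace.complexify ∘ u) k =
      L (mFourierCoeff (EuclideanSpace.complexify ∘ u) (Matrix.vecMul k (reflMat i))) := by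
    intro k
    rw [hL, ← mFourierCoeff_complexify_conj_reflMat hu i k]
    refine Torus.mFourierCoeff_congr_ae ?_ k
    filter_upwards [hsym i] with x hx
    simp only [Function.comp_apply]
    rw [hx, actVec_actVec]
  -- the conjugated truncation has the coefficients of the truncation
  have hcoef : ∀ k, mFourierCoeff (EuclideanSpace.complexify ∘ fun x =>
      actVec (reflMat i) (Torus.fourierTruncate N u (Torus.mulVecT (reflMat i) x))) k =
      mFourierCoeff (EuclideanSpace.complexify ∘ Torus.fourierTruncate N u) k := by
    intro k
    rw [mFourierCoeff_complexify_conj_reflMat hPs.integrable i k, ← hL, Torus.mFourierCoeff_fourierTruncate hu,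
      Torus.mFourierCoeff_fourierTruncate hu]
    by_cases hk : k ∈ Torus.freqBall N
    · rw [if_pos ((vecMul_reflMat_mem_freqBall_iff i N k).2 hk), if_pos hk, ← hu_coef k]
    · rw [if_neg (fun h => hk ((vecMul_reflMat_mem_freqBall_iff i N k).1 h)), if_neg hk, map_zero]
  have heq := Torus.IsSmooth.ext_mFourierCoeff hQs.complexify_comp hPs.complexify_comp hcoef
  funext x
  exact EuclideanSpace.complexify_injective (congrFun heq x)

/-- The crux's a.e. mirror class, read vectorially: for `v ∈ Fix K`, `v (R_i x) = R_i (v x)` for a.e. `x`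
(`update x i (−x i) = R_i • x`, `(R_i w)_j = ∓w_j`). [folklore] -/
theorem ae_conj_of_mem_mirrorClass :
    ∀ v : Torus.energySpace (Fin 3), v ∈ mirrorClass → ∀ i : Fin 3,
      (fun x => ((v : Lp (EuclideanSpace ℝ (Fin 3)) 2 (volume : Measure (UnitAddTorus (Fin 3)))) :
          UnitAddTorus (Fin 3) → EuclideanSpace ℝ (Fin 3)) (Torus.mulVecT (reflMat i) x)) =ᵐ[volume]
      fun x => actVec (reflMat i)
        (((v : Lp (EuclideanSpace ℝ (Fin 3)) 2 (volume : Measure (UnitAddTorus (Fin 3)))) :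
          UnitAddTorus (Fin 3) → EuclideanSpace ℝ (Fin 3)) x) := by
  intro v hv i
  have h : ∀ᵐ x ∂(volume : Measure (UnitAddTorus (Fin 3))), ∀ i' : Fin 3,
      ((v : Lp (EuclideanSpace ℝ (Fin 3)) 2 (volume : Measure (UnitAddTorus (Fin 3)))) :
          UnitAddTorus (Fin 3) → EuclideanSpace ℝ (Fin 3)) (Function.update x i (-x i)) i' =
        if i' = i then
          -(((v : Lp (EuclideanSpace ℝ (Fin 3)) 2 (volume : Measure (UnitAddTorus (Fin 3)))) :
            UnitAddTorus (Fin 3) → EuclideanSpace ℝ (Fin 3)) x i')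
        else ((v : Lp (EuclideanSpace ℝ (Fin 3)) 2 (volume : Measure (UnitAddTorus (Fin 3)))) :
            UnitAddTorus (Fin 3) → EuclideanSpace ℝ (Fin 3)) x i' :=
    ae_all_iff.2 fun i' => hv i i'
  filter_upwards [h] with x hx
  rw [← update_neg_eq_mulVecT]
  ext j
  rw [actVec_reflMat_apply, hx j]

/-- `K`-symmetry in the crux's coordinatewise form: `U (R_i x)_j = ∓ U(x)_j`. [folklore] -/
theorem coord_of_isKSymm {U : UnitAddTorus (Fin 3) → EuclideanSpace ℝ (Fin 3)} (h : IsKSymm U)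
    (i j : Fin 3) (x : UnitAddTorus (Fin 3)) :
    U (Function.update x i (-x i)) j = if j = i then -(U x j) else U x j := by
  rw [update_neg_eq_mulVecT, h i x, actVec_reflMat_apply]

/-- **Truncations of mirror-class fields are exactly mirror symmetric**, in the crux's coordinatewise form:
for `v ∈ Fix K ⊆ H` and every `N`, `P_N v (R_i x)_j = ∓ P_N v (x)_j` for ALL `x` (`ae_conj_of_mem_mirrorClass`,
`isKSymm_fourierTruncate_of_ae`, `coord_of_isKSymm`). [folklore] -/
theorem fourierTruncate_mirror_of_mem_mirrorClass :
    ∀ v : Torus.energySpace (Fin 3), v ∈ mirrorClass → ∀ (N : ℕ) (i j : Fin 3) (x : UnitAddTorus (Fin 3)),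
      Torus.fourierTruncate N ((v : Lp (EuclideanSpace ℝ (Fin 3)) 2 (volume : Measure (UnitAddTorus (Fin 3)))) :
          UnitAddTorus (Fin 3) → EuclideanSpace ℝ (Fin 3)) (Function.update x i (-x i)) j =
        if j = i then
          -(Torus.fourierTruncate N ((v : Lp (EuclideanSpace ℝ (Fin 3)) 2 (volume : Measure (UnitAddTorus (Fin 3)))) :
            UnitAddTorus (Fin 3) → EuclideanSpace ℝ (Fin 3)) x j)
        else Torus.fourierTruncate N ((v : Lp (EuclideanSpace ℝ (Fin 3)) 2 (volume : Measure (UnitAddTorus (Fin 3)))) :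
            UnitAddTorus (Fin 3) → EuclideanSpace ℝ (Fin 3)) x j :=
  fun v hv N => coord_of_isKSymm
    (isKSymm_fourierTruncate_of_ae ((Lp.memLp _).integrable one_le_two) (ae_conj_of_mem_mirrorClass v hv) N)

/-! ## Limits: local `L²` masses and the inertial pairing along the truncations -/

/-- **`L²` convergence passes to the local `L²` mass on any set**: if `fₙ → g` in `L²(T³; ℝ³)` then
`∫⁻_S ‖fₙ‖ₑ² → ∫⁻_S ‖g‖ₑ²` for every `S ⊆ T³` (restriction to `S` is a contraction of `L²`, and the norm
is continuous on `L²(S)`). [folklore] -/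
theorem tendsto_setLIntegral_enorm_sq {f : ℕ → UnitAddTorus (Fin 3) → EuclideanSpace ℝ (Fin 3)}
    {g : UnitAddTorus (Fin 3) → EuclideanSpace ℝ (Fin 3)} (hf : ∀ n, MemLp (f n) 2 volume)
    (hg : MemLp g 2 volume) (h : Tendsto (fun n => eLpNorm (f n - g) 2 volume) atTop (𝓝 0))
    (S : Set (UnitAddTorus (Fin 3))) :
    Tendsto (fun n => ∫⁻ x in S, ‖f n x‖ₑ ^ 2) atTop (𝓝 (∫⁻ x in S, ‖g x‖ₑ ^ 2)) := by
  set μ : Measure (UnitAddTorus (Fin 3)) := volume.restrict S with hμ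
  have hfS : ∀ n, MemLp (f n) 2 μ := fun n => (hf n).restrict S
  have hgS : MemLp g 2 μ := hg.restrict S
  have hS : Tendsto (fun n => eLpNorm (f n - g) 2 μ) atTop (𝓝 0) :=
    tendsto_of_tendsto_of_tendsto_of_le_of_le tendsto_const_nhds h (fun _ => zero_le)
      fun n => eLpNorm_mono_measure _ Measure.restrict_le_self
  have hLp : Tendsto (fun n => (hfS n).toLp (f n)) atTop (𝓝 (hgS.toLp g)) :=
    (Lp.tendsto_Lp_iff_tendsto_eLpNorm'' f hfS g hgS).2 hS
  have hnorm : Tendsto (fun n => ‖(hfS n).toLp (f n)‖ₑ ^ 2) atTop (𝓝 (‖hgS.toLp g‖ₑ ^ 2)) :=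
    ((ENNReal.continuous_pow 2).tendsto _).comp ((continuous_enorm.tendsto _).comp hLp)
  simp only [Lp.enorm_toLp] at hnorm
  simpa only [lintegral_enorm_sq_eq_sq_eLpNorm_two] using hnorm

/-- The local `L²` mass of a vector of fields, with the finite sum outside. [folklore] -/
theorem setLIntegral_sum_enorm_sq {f : Fin 3 → UnitAddTorus (Fin 3) → EuclideanSpace ℝ (Fin 3)}
    (hf : ∀ j, AEStronglyMeasurable (f j) volume) (S : Set (UnitAddTorus (Fin 3))) :
    ∫⁻ x in S, ∑ j, ‖f j x‖ₑ ^ 2 = ∑ j, ∫⁻ x in S, ‖f j x‖ₑ ^ 2 :=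
  lintegral_finsetSum' _ fun j _ => ((hf j).enorm.pow_const 2).restrict

/-- **The local enstrophy of the truncations converges**: for `wⱼ ∈ L²(T³; ℝ³)` and every set `S`,
`∫⁻_S ∑ⱼ ‖P_N wⱼ‖ₑ² → ∫⁻_S ∑ⱼ ‖wⱼ‖ₑ²` (`P_N wⱼ → wⱼ` in `L²`, Robinson–Rodrigo–Sadowski 2016, Lemma 4.1,
`Torus.tendsto_eLpNorm_fourierTruncate_sub`). [cite: RobinsonRodrigoSadowski2016, Lemma 4.1, p. 74] -/
theorem tendsto_setLIntegral_sum_enorm_sq_fourierTruncate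
    {w : Fin 3 → UnitAddTorus (Fin 3) → EuclideanSpace ℝ (Fin 3)} (hw : ∀ j, MemLp (w j) 2 volume)
    (S : Set (UnitAddTorus (Fin 3))) :
    Tendsto (fun N : ℕ => ∫⁻ x in S, ∑ j, ‖Torus.fourierTruncate N (w j) x‖ₑ ^ 2) atTop
      (𝓝 (∫⁻ x in S, ∑ j, ‖w j x‖ₑ ^ 2)) := by
  have h1 : ∀ N : ℕ, ∫⁻ x in S, ∑ j, ‖Torus.fourierTruncate N (w j) x‖ₑ ^ 2 =
      ∑ j, ∫⁻ x in S, ‖Torus.fourierTruncate N (w j) x‖ₑ ^ 2 := fun N =>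
    setLIntegral_sum_enorm_sq (fun j => (Torus.memLp_fourierTruncate N (w j) 2).1) S
  simp_rw [h1, setLIntegral_sum_enorm_sq (fun j => (hw j).1) S]
  exact tendsto_finsetSum _ fun j _ => tendsto_setLIntegral_enorm_sq
    (fun N => Torus.memLp_fourierTruncate N (w j) 2) (hw j) (Torus.tendsto_eLpNorm_fourierTruncate_sub (hw j)) S

/-- **The inertial pairing along the truncations**: for an `L²` class `v` and a smooth field `g`,
`∫ ⟪∇g (P_N v), P_N v⟫ → ∫ (v ⊗ v) : ∇g = Torus.inertialPairing v g` (`P_N v → v` in `L²`,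
`Torus.tendsto_toLp_fourierTruncate`, and the pairing is norm-continuous on `L²`,
`Torus.continuous_inertialPairing`; FMRT 2001, Ch. IV (1.9)). [cite: FMRTTurbulence2001, Ch. IV §1.1 (1.9)] -/
theorem tendsto_inertialPairing_fourierTruncate
    (v : Lp (EuclideanSpace ℝ (Fin 3)) 2 (volume : Measure (UnitAddTorus (Fin 3))))
    {g : UnitAddTorus (Fin 3) → EuclideanSpace ℝ (Fin 3)} (hg : Torus.IsSmooth g) :
    Tendsto (fun N : ℕ => ∫ x, ⟪Torus.fderiv g x
        (Torus.fourierTruncate N (v : UnitAddTorus (Fin 3) → EuclideanSpace ℝ (Fin 3)) x),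
        Torus.fourierTruncate N (v : UnitAddTorus (Fin 3) → EuclideanSpace ℝ (Fin 3)) x⟫_ℝ) atTop
      (𝓝 (Torus.inertialPairing v g)) := by
  have h := ((Torus.continuous_inertialPairing hg).tendsto v).comp (Torus.tendsto_toLp_fourierTruncate v)
  refine h.congr fun N => ?_
  simp only [Function.comp_apply, Torus.inertialPairing]
  refine integral_congr_ae ?_
  filter_upwards [Torus.coeFn_toLp_fourierTruncate N v] with x hx
  rw [hx]

/-- Bookkeeping: `ofReal (∫_S ∑ⱼ ‖fⱼ‖²) = ∫⁻_S ∑ⱼ ‖fⱼ‖ₑ²` for continuous `fⱼ`. [folklore] -/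
theorem ofReal_setIntegral_sum_norm_sq {f : Fin 3 → UnitAddTorus (Fin 3) → EuclideanSpace ℝ (Fin 3)}
    (hf : ∀ j, Continuous (f j)) (S : Set (UnitAddTorus (Fin 3))) :
    ENNReal.ofReal (∫ x in S, ∑ j, ‖f j x‖ ^ 2) = ∫⁻ x in S, ∑ j, ‖f j x‖ₑ ^ 2 := by
  have hint : Integrable (fun x => ∑ j, ‖f j x‖ ^ 2) ((volume : Measure (UnitAddTorus (Fin 3))).restrict S) :=
    ((continuous_finsetSum _ fun j _ => ((hf j).norm.pow 2)).integrable_unitAddTorus).restrict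
  rw [ofReal_integral_eq_lintegral_ofReal hint (ae_of_all _ fun x => Finset.sum_nonneg fun j _ => sq_nonneg _)]
  refine lintegral_congr fun x => ?_
  rw [ENNReal.ofReal_sum_of_nonneg fun j _ => sq_nonneg _]
  refine Finset.sum_congr rfl fun j _ => ?_
  rw [← ofReal_norm, ENNReal.ofReal_pow (norm_nonneg _)]

/-! ## The registered tools sub-stub -/

/-- **Tools sub-stub `stub_tubeLawTransferKTools`** of `stub_tubeLawTransferK` (T3, line `regimes`, crux
stmt-AnomalousDissipation-17693): the conjunction of this file's ingredients — square-integrable weak gradients of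
finite-enstrophy fields, truncation commutes with weak derivatives, exact mirror symmetry of the truncations of
mirror-class fields, convergence of the local enstrophy of the truncated weak gradient, convergence of the
inertial pairing along the truncations, and the `ofReal`/`lintegral` bookkeeping. [folklore] -/
theorem stub_tubeLawTransferKTools :
    (∀ u : UnitAddTorus (Fin 3) → EuclideanSpace ℝ (Fin 3), MemLp u 2 volume → Torus.eGradNormSq u ≠ ⊤ → ∃ w : Fin 3 → UnitAddTorus (Fin 3) → EuclideanSpace ℝ (Fin 3), (∀ j, Torus.HasWeakPartialDeriv j u (w j)) ∧ (∀ j, MemLp (w j) 2 volume)) ∧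
    (∀ (j : Fin 3) (u w : UnitAddTorus (Fin 3) → EuclideanSpace ℝ (Fin 3)), Integrable u volume → Integrable w volume → Torus.HasWeakPartialDeriv j u w → ∀ N : ℕ, Torus.partialDeriv j (Torus.fourierTruncate N u) = Torus.fourierTruncate N w) ∧
    (∀ v : Torus.energySpace (Fin 3), v ∈ mirrorClass → ∀ (N : ℕ) (i j : Fin 3) (x : UnitAddTorus (Fin 3)), Torus.fourierTruncate N ((v : Lp (EuclideanSpace ℝ (Fin 3)) 2 (volume : Measure (UnitAddTorus (Fin 3)))) : UnitAddTorus (Fin 3) → EuclideanSpace ℝ (Fin 3)) (Function.update x i (-x i)) j = if j = i then -(Torus.fourierTruncate N ((v : Lp (EuclideanSpace ℝ (Fin 3)) 2 (volume : Measure (UnitAddTorus (Fin 3)))) : UnitAddTorus (Fin 3) → EuclideanSpace ℝ (Fin 3)) x j) else Torus.fourierTruncate N ((v : Lp (EuclideanSpace ℝ (Fin 3)) 2 (volume : Measure (UnitAddTorus (Fin 3)))) : UnitAddTorus (Fin 3) → EuclideanSpace ℝ (Fin 3)) x j) ∧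
    (∀ (w : Fin 3 → UnitAddTorus (Fin 3) → EuclideanSpace ℝ (Fin 3)) (S : Set (UnitAddTorus (Fin 3))), (∀ j, MemLp (w j) 2 volume) → Filter.Tendsto (fun N : ℕ => ∫⁻ x in S, ∑ j, ‖Torus.fourierTruncate N (w j) x‖ₑ ^ 2) Filter.atTop (nhds (∫⁻ x in S, ∑ j, ‖w j x‖ₑ ^ 2))) ∧
    (∀ (v : Lp (EuclideanSpace ℝ (Fin 3)) 2 (volume : Measure (UnitAddTorus (Fin 3)))) (g : UnitAddTorus (Fin 3) → EuclideanSpace ℝ (Fin 3)), Torus.IsSmooth g → Filter.Tendsto (fun N : ℕ => ∫ x, ⟪Torus.fderiv g x (Torus.fourierTruncate N (v : UnitAddTorus (Fin 3) → EuclideanSpace ℝ (Fin 3)) x), Torus.fourierTruncate N (v : UnitAddTorus (Fin 3) → EuclideanSpace ℝ (Fin 3)) x⟫_ℝ) Filter.atTop (nhds (Torus.inertialPairing v g))) ∧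
    (∀ (f : Fin 3 → UnitAddTorus (Fin 3) → EuclideanSpace ℝ (Fin 3)) (S : Set (UnitAddTorus (Fin 3))), (∀ j, Continuous (f j)) → ENNReal.ofReal (∫ x in S, ∑ j, ‖f j x‖ ^ 2) = ∫⁻ x in S, ∑ j, ‖f j x‖ₑ ^ 2) :=
  ⟨exists_hasWeakPartialDeriv_of_eGradNormSq_ne_top, partialDeriv_fourierTruncate_of_hasWeakPartialDeriv,
    fourierTruncate_mirror_of_mem_mirrorClass,
    fun _ S hw => tendsto_setLIntegral_sum_enorm_sq_fourierTruncate hw S,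
    fun v _ hg => tendsto_inertialPairing_fourierTruncate v hg,
    fun _ S hf => ofReal_setIntegral_sum_norm_sq hf S⟩

end Summit.AnomalousDissipation.AnomalousDissipation.Theorems.MirrorEnsembleMirrorStatisticsLoudTG

end
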